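import Summits.Langlands.Langlands.Theorems.NonParallelVoidTwistedInductionParallelSymmetriseDefs
import Literature.NumberTheory.GaloisCohomology.PoitouTateSha
import Literature.NumberTheory.GaloisCohomology.ShaOneMuPrime
import Literature.NumberTheory.GaloisRepresentations.TateH2VanishingGlobalAssembly
import Literature.NumberTheory.GaloisRepresentations.TateH2VanishingCocycleClass
import Literature.NumberTheory.GaloisRepresentations.TateH2VanishingCorestriction
import Literature.NumberTheory.GaloisRepresentations.TateH2VanishingReduction
import Literature.NumberTheory.GaloisRepresentations.TateH2VanishingCharacterCriterion
import Literature.NumberTheory.GaloisRepresentations.TateLevelOneHasseBridge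
import Literature.NumberTheory.GaloisRepresentations.AbsGaloisGroupCompact
import HarnessLib

/-!
# Route `NonParallelVoid`, crux `TwistedInductionParallel` (stmt-Langlands-17000), line `symmetrise-pd-split`:
# stub 1-C1 `stub_twoDivisible_of_locally` — global 2-divisibility of a finite-order character is local

For a totally complex number field `E` and a locally constant additive character `ν : Γ_E → ℚ/ℤ`, if
at every finite place `w` the restriction `ν ∘ res_w` to `Γ_{E_w}` is twice a locally constant
character, then `ν` is twice a locally constant character of `Γ_E` — granted the tree's named fact
`poitouTate_sha_zmod_mu E` (Poitou–Tate duality of `Ш¹(E, μ_m)` and `Ш²(E, ℤ/m)`, Harari Thm. 17.13 (b)).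

Proof (the template is `twoCocycle_addCircle_prime_split_of_localGlobal`,
`TateH2VanishingGlobalAssembly.lean`): with `c₀ = ν/2` (a division function on `ℚ/ℤ`), the Bockstein
cocycle `d = ∂c₀` is a locally constant `2`-torsion `2`-cocycle; its class `x ∈ H²(Γ_E, ℤ/2)`
(`exists_contTwoCocycles_zmod_of_addCircle`, `twoCocycleClass`) has vanishing localisation at every
finite place (the local square root `μ_w` gives the `2`-torsion splitting `β = c₀ ∘ res_w − μ_w`,
`map_twoCocycleClass_trivial_eq_zero_iff`) and at every infinite place (all complex: `Γ_ℂ = 1`,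
`subsingleton_absoluteGaloisGroup_completion_of_isComplex`, splitting by the constant `c₀ 1`); hence
`x = 0` by `Ш²(E, ℤ/2) = 0` (`eq_zero_of_forall_localization_eq_zero_of_isPrimitiveRoot` at `p = 2`,
`ζ = -1`, from the named fact and the PROVED `Ш¹(E, μ₂) = 0`), i.e. `d = ∂β` with `β` locally constant
and `2 β = 0` (`twoCocycleClass_trivial_eq_zero_iff`); `μ = c₀ − β` is the global square root.

## References

* D. Harari, *Galois Cohomology and Class Field Theory* (2020), Thm. 17.13 (b), Cor. 18.12,
  Thm. 18.15 (proof). [Harari2020]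
* J.-P. Serre, *Modular forms of weight one and Galois representations* (Durham 1975), 1977, §6.5.
  [`SerreDurham1977`]
-/

noncomputable section

open scoped NumberField
open NumberField IsDedekindDomain Field Filter
open Literature.NumberTheory.GaloisRepresentations

-- `Summit.Langlands.Langlands.…` repeats a namespace component by design (D-0017 nested layout).
set_option linter.dupNamespace false

namespace Summit.Langlands.Langlands.Cruxes.TwistedInductionParallel.SymmetrisePdSplit

/-- **STUB 1-C1 (v9) — global 2-divisibility of a finite-order character is local** (size M).
For a totally complex number field `E` and a locally constant additive character `ν : Γ_E → ℚ/ℤ`, if at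
every finite place `w` the restriction `ν ∘ res_w` to `Γ_{E_w}` is twice a locally constant character, then
`ν` is twice a locally constant character of `Γ_E`.  Proof: the Bockstein cocycle `∂(ν/2)` is a
`ℤ/2`-valued locally constant 2-cocycle whose class in `H²(Γ_E, ℤ/2)` has vanishing localisations
(finite places: hypothesis; complex places: `Γ_ℂ = 1`), hence vanishes by `Ш²(E, ℤ/2) = 0`
(`eq_zero_of_forall_localization_eq_zero_of_isPrimitiveRoot` at `p = 2`, `ζ = -1`, from the named fact
`poitouTate_sha_zmod_mu E` and the PROVED `Ш¹(E, μ₂) = 0`); template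
`twoCocycle_addCircle_prime_split_of_localGlobal`.  Leading hypothesis: the named fact (in print:
Poitou–Tate duality, Harari Thm. 17.13). [cite: Harari2020, Thm. 17.13 (b), Cor. 18.12] [cite: SerreDurham1977, §6.5] -/
theorem stub_twoDivisible_of_locally :
    ∀ (E : Type) [Field E] [NumberField E] [NumberField.IsTotallyComplex E],
    Literature.NumberTheory.GaloisCohomology.poitouTate_sha_zmod_mu E →
    ∀ (ν : absoluteGaloisGroup E → AddCircle (1 : ℚ)),
      IsLocallyConstant ν → (∀ σ τ, ν (σ * τ) = ν σ + ν τ) →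
      (∀ w : HeightOneSpectrum (𝓞 E),
        ∃ μ : absoluteGaloisGroup (w.adicCompletion E) → AddCircle (1 : ℚ),
          IsLocallyConstant μ ∧ (∀ σ τ, μ (σ * τ) = μ σ + μ τ) ∧
          ∀ σ, 2 • μ σ = ν (absGaloisRestrict E (w.adicCompletion E) σ)) →
      ∃ μ : absoluteGaloisGroup E → AddCircle (1 : ℚ),
        IsLocallyConstant μ ∧ (∀ σ τ, μ (σ * τ) = μ σ + μ τ) ∧ ∀ σ, 2 • μ σ = ν σ := by
  intro E _ _ _ hPT ν hν_lc hνmul hloc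
  classical
  -- `c₀ = ν / 2` and the `2`-torsion Bockstein cocycle `d = ∂c₀`
  obtain ⟨h, hh⟩ := addCircle_exists_fun_nsmul_eq (two_pos : 0 < 2)
  set c₀ : absoluteGaloisGroup E → AddCircle (1 : ℚ) := h ∘ ν with hc₀_def
  have hc₀_lc : IsLocallyConstant c₀ := hν_lc.comp h
  have hc₀2 : ∀ σ, 2 • c₀ σ = ν σ := fun σ => hh (ν σ)
  set d : absoluteGaloisGroup E → absoluteGaloisGroup E → AddCircle (1 : ℚ) :=
    fun σ τ => c₀ σ + c₀ τ - c₀ (σ * τ) with hd_def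
  have hd_lc : IsLocallyConstant (Function.uncurry d) := isLocallyConstant_coboundary hc₀_lc
  have hd_coc : ∀ σ τ υ, d σ τ + d (σ * τ) υ = d τ υ + d σ (τ * υ) := fun σ τ υ =>
    coboundary_isTwoCocycle c₀ σ τ υ
  have hd_2 : ∀ σ τ, 2 • d σ τ = 0 := fun σ τ => by
    simp only [hd_def]
    rw [nsmul_sub, nsmul_add, hc₀2, hc₀2, hc₀2, hνmul, sub_self]
  -- the class `x ∈ H²(Γ_E, ℤ/2)` of `d`
  obtain ⟨e, he, -, hes⟩ := zmod_exists_addMonoidHom_addCircle (two_pos : 0 < 2)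
  obtain ⟨γ, hγ⟩ := exists_contTwoCocycles_zmod_of_addCircle e he hes d hd_lc hd_coc hd_2
  let ρ : DiscreteGaloisModule E (ZMod 2) :=
    ContinuousRep.trivial (absoluteGaloisGroup E) ℤ (ZMod 2)
  let x : galoisCohomology ρ 2 := twoCocycleClass _ γ
  -- `x` vanishes at every place
  have hxloc : ∀ v : Place E, galoisCohomology.localization ρ v 2 x = 0 := by
    intro v
    haveI : CompactSpace (absoluteGaloisGroup (Place.Completion v)) :=
      absoluteGaloisGroup_compactSpace (Place.Completion v)
    rw [galoisCohomology.localization_apply_eq]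
    refine (map_twoCocycleClass_trivial_eq_zero_iff e he hes γ
      (absGaloisRestrict E (Place.Completion v))).2 ?_
    rcases v with w | w
    · -- infinite place: complex since `E` is totally complex, so `Γ_{E_w}` is trivial
      haveI : Subsingleton (absoluteGaloisGroup (Place.Completion (Sum.inl w : Place E))) :=
        subsingleton_absoluteGaloisGroup_completion_of_isComplex w
          (NumberField.IsTotallyComplex.isComplex w)
      refine ⟨fun _ => c₀ 1, IsLocallyConstant.const _, fun _ => ?_, fun σ τ => ?_⟩
      · rw [hc₀2, character_apply_one hνmul]
      · rw [hγ, Subsingleton.elim σ 1, Subsingleton.elim τ 1, map_one, mul_one]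
        simp only [hd_def]
        rw [mul_one]
    · -- finite place (`Place.Completion (Sum.inr w) = w.adicCompletion E` by definition): the local
      -- square root `μ_w` of `ν ∘ res_w` gives the `2`-torsion splitting `c₀ ∘ res_w - μ_w`
      change ∃ β : absoluteGaloisGroup (w.adicCompletion E) → AddCircle (1 : ℚ),
        IsLocallyConstant β ∧ (∀ h, 2 • β h = 0) ∧
          ∀ σ τ, e (γ.1 (absGaloisRestrict E (w.adicCompletion E) σ,
            absGaloisRestrict E (w.adicCompletion E) τ)) = β σ + β τ - β (σ * τ)
      obtain ⟨μ, hμ_lc, hμmul, hμ2⟩ := hloc w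
      refine ⟨fun σ => c₀ (absGaloisRestrict E (w.adicCompletion E) σ) - μ σ,
        (hc₀_lc.comp_continuous
          (map_continuous (absGaloisRestrict E (w.adicCompletion E)))).comp₂ hμ_lc (· - ·),
        fun σ => ?_, fun σ τ => ?_⟩
      · simp only
        rw [nsmul_sub, hc₀2, hμ2, sub_self]
      · rw [hγ]
        simp only [hd_def]
        rw [map_mul, hμmul]
        abel
  -- `Ш²(E, ℤ/2) = 0`: `x = 0`, so `d = ∂β` with `β` locally constant and `2 β = 0`
  have hζ : IsPrimitiveRoot (-1 : E) 2 := IsPrimitiveRoot.neg_one 0 (by decide)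
  have hx : x = 0 :=
    Literature.NumberTheory.GaloisCohomology.eq_zero_of_forall_localization_eq_zero_of_isPrimitiveRoot
      hPT Nat.prime_two hζ x hxloc
  obtain ⟨β, hβ_lc, hβ2, hβ⟩ := (twoCocycleClass_trivial_eq_zero_iff e he hes γ).1 hx
  -- `μ = c₀ - β`
  refine ⟨fun σ => c₀ σ - β σ, hc₀_lc.comp₂ hβ_lc (· - ·), fun σ τ => ?_, fun σ => ?_⟩
  · have e1 := hβ σ τ
    rw [hγ] at e1
    change c₀ σ + c₀ τ - c₀ (σ * τ) = β σ + β τ - β (σ * τ) at e1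
    simp only
    rw [← sub_eq_zero]
    have e2 : c₀ (σ * τ) - β (σ * τ) - (c₀ σ - β σ + (c₀ τ - β τ)) =
        (β σ + β τ - β (σ * τ)) - (c₀ σ + c₀ τ - c₀ (σ * τ)) := by abel
    rw [e2, e1, sub_self]
  · simp only
    rw [nsmul_sub, hc₀2, hβ2, sub_zero]

end Summit.Langlands.Langlands.Cruxes.TwistedInductionParallel.SymmetrisePdSplit

end
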